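import Summits.BirchSwinnertonDyer.BirchSwinnertonDyer.Theorems.ResidualThetaTransportAtTwoKatoZetaDefs
import Summits.BirchSwinnertonDyer.BirchSwinnertonDyer.Theorems.ThetaPartnerAtTwoSignedKatoUpToAtTwoKatoBKCoreKZLit
import Summits.BirchSwinnertonDyer.BirchSwinnertonDyer.Theorems.ThetaPartnerAtTwoSignedKatoUpToAtTwoCyclotomicPadicEmbedding
import Literature.NumberTheory.EllipticCurves.Kato2004.ZetaElementNewformTatePairingValuesTwo
import Literature.NumberTheory.EllipticCurves.CMNewformGamma0LevelSquarefull
import Literature.NumberTheory.EllipticCurves.Kato2004.IwasawaCohomologyCoeffNewform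
import HarnessLib

/-!
# Sketch (stub-ideation k = 3, g29) — `stub_cmLambdaLower` ≡ RSL_g: the CHILD-A PORT as a DECOMPOSITION WITH PROVED GLUE
# `Kato2004.exists_zetaElement_newform_tatePairing_values_two` (LANDED p726418) ⟹ `OnePair.stub_kzgChildA` (onepair.lean v3h l.105–107, VERBATIM)

Crux `ResidualThetaCountLowerPureAtTwo` (stmt-BirchSwinnertonDyer-26074), stub `stub_cmLambdaLower` = item 22608 RSL_g; node = the PRINT child A
`stub_kzgChildA` of line «onepair» (registered v3h, 2026-08-29T15:03:48Z). EVENT: the typer's named fact (Kato Thm 12.5 (1) at `p = 2`,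
`𝒪_λ`-coefficients, typed AT THE PINS in KATO's coordinates `(z, ℓ, L, f, u, r)`) is in the tree; the consumer's child A wants the class in the
ONE-PAIR coordinates `(z, c′, w, q, μt)` of `OnePairPins.KatoValuedClass`. This file CUTS the remaining kernel port into named sub-lemmas and
PROVES the glue:

* §1 PIN LINEAR ALGEBRA over the Frobenius datum `(t₀, bO, bO′)` of the pins (pure algebra, no curve): `t0_mul_eq_sum` (the contraction
  `t₀(xy) = Σ_j t₀(x bO_j) t₀(y bO′_j)`), `coe_eq_sum` (`φ = Σ_j t₀(φ bO′_j) bO_j` in `ℚ̄₂`), `exists_functionalRepr` (D1: every `ℚ₂`-linear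
  `ℓ_i` is `2^{-s} t₀(c′_i ·)` on `𝒪`, `c′_i ∈ 𝒪`), `exists_pow_two_mul_eq_coe` (D2: common `2`-power denominators in `F_λ = 𝒪[1/2]`).
* §2 THE DICTIONARY `dict`/`wcoord` (`w_{N,j} := Σ_k 2^{-s-t_N} t₀(φ_{N,k} bO′_j) · e_N(u_{N,k})`) and the three CLAUSE TRANSFERS, proved as
  abstract finite-sum identities: `bk_transfer` ((BK) ⟹ (BKρ): constants OUTSIDE the Galois sums, `τ` is `ℚ₂`-semilinear),
  `val_transfer` / `triv_transfer` (recombination `Σ_j bO_j · dict_{jk} = 2^{-s} ι f_{N,k}`).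
* §3 FRAME: `exists_embedding_tower` (`e_k : ℚ(ζ_{2^k}) → ℚ̄₂`, `e_k(ζ) = PadicCyclotomicTower.zeta 2 k`, TP2's
  `KatoValue.exists_ringHom_zeta_eq_padicZeta` BY NAME; coherence from `zeta_succ_pow`; `e ∘ σ_b = τ_b • e` from `KatoValue.map_sigma_eq_smul`).
* §4 THE GLUE, PROVED: `stub_kzgChildA_of_fact : Kato2004.exists_zetaElement_newform_tatePairing_values_two → <stub_kzgChildA's registered text,
  VERBATIM incl. the `open … in` prefix>` — instantiate the fact at `(π, F)` binder for binder (the typer's PLUG), log bridge by TP2's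
  `KatoBK.ptLogΩ_toLoc_symm_eq` + `toLoc_symm_mem_kernel_iff`, `q := 2^{-s} ι(r) ≠ 0`, `μt := 1`, (ND) from Kato's (ND), (TRIVρ) from (TRIV) at
  `a₂(g) = 0`, `M` odd (factor `3/2`).
HONEST FRAMING: nothing about any curve or form is asserted; every `theorem` here is kernel glue over hypotheses; the named fact is a HYPOTHESIS
(`hK`); BSD is NOT proved; 22608 / 26074 / 24105 stay OPEN / HOLD; no route, registry or Theorems object is touched. placeholder-free (see the check record in the idea card).
-/

set_option autoImplicit false
set_option linter.dupNamespace false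
set_option backward.isDefEq.respectTransparency false

noncomputable section

open scoped Classical NumberField TensorProduct

namespace Summit.BirchSwinnertonDyer.BirchSwinnertonDyer.Cruxes.ResidualThetaCountLowerPureAtTwo.SideaK3G29

open Literature.NumberTheory.EllipticCurves Literature.NumberTheory.EllipticCurves.GreenbergSelmer
open Literature.NumberTheory.EllipticCurves.ModularForms Literature.NumberTheory.Automorphic
open Literature.NumberTheory.GaloisRepresentations NumberField IsDedekindDomain Field
open GreenbergVatsal2000 Kobayashi2003 Rat.HeightOneSpectrum PowerSeries
open Literature.NumberTheory.EllipticCurves.FormalGroupChart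
open Summit.BirchSwinnertonDyer.Rank1Residual.Additive Summit.BirchSwinnertonDyer.Rank1Residual.Additive.PadicCyclotomicTower
  Summit.BirchSwinnertonDyer.Rank1Residual.Additive.BallEval
open Summit.BirchSwinnertonDyer.BirchSwinnertonDyer.Theorems.SignedKatoOffTwo
  Summit.BirchSwinnertonDyer.BirchSwinnertonDyer.Theorems.SignedKatoOffTwo.LocalTwo
open Summit.BirchSwinnertonDyer.BirchSwinnertonDyer.Theorems.OnePair

/-! ## §0 Small plumbing -/

/-- `‖2‖ = 1/2` in `ℚ₂`. [folklore] -/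
theorem norm_two_padic : ‖(2 : ℚ_[2])‖ = ((2 : ℝ))⁻¹ := by
  simpa using Padic.norm_p (p := 2)

/-- `‖2‖ = 1/2` in `ℚ̄₂`. [folklore] -/
theorem norm_two_padicAlgCl : ‖(2 : PadicAlgCl 2)‖ = ((2 : ℝ))⁻¹ := by
  have h := PadicAlgCl.norm_extends (p := 2) (2 : ℚ_[2])
  have h2 : ((2 : ℚ_[2]) : PadicAlgCl 2) = 2 := map_ofNat (algebraMap ℚ_[2] (PadicAlgCl 2)) 2
  rw [h2, norm_two_padic] at h
  exact h

/-- Archimedean bookkeeping: `2^{-t'} r ≤ 1` for all large `t'`. [folklore] -/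
theorem exists_pow_half_mul_le (r : ℝ) : ∃ t : ℕ, ∀ t' : ℕ, t ≤ t' → ((2 : ℝ) ^ t')⁻¹ * r ≤ 1 := by
  obtain ⟨t, ht⟩ := pow_unbounded_of_one_lt r (by norm_num : (1 : ℝ) < 2)
  refine ⟨t, fun t' htt' => ?_⟩
  rw [inv_mul_le_iff₀ (by positivity), mul_one]
  exact ht.le.trans (pow_le_pow_right₀ (by norm_num) htt')

/-- `RingHom.toRatAlgHom` is the same function. [folklore] -/
theorem toRatAlgHom_apply' {R T : Type*} [Ring R] [Ring T] [Algebra ℚ R] [Algebra ℚ T] (f : R →+* T) (x : R) :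
    f.toRatAlgHom x = f x := rfl

/-- `AddChar.zmodChar` only depends on the root. [folklore] -/
theorem zmodChar_congr_root {n : ℕ} [NeZero n] {ζ ζ' : PadicAlgCl 2} (h : ζ = ζ') (h1 : ζ ^ n = 1) (h2 : ζ' ^ n = 1) :
    AddChar.zmodChar n h1 = AddChar.zmodChar n h2 := by
  subst h; rfl

/-- The `Λ_𝒪`-multiplier `μt := 1` evaluates to `1`: `Σ_k coeff_k(1) · y^k = 1`. [folklore] -/
theorem tsum_coeff_one_mul_pow {S : Set (PadicAlgCl 2)} (y : ℂ_[2]) :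
    ∑' k, algebraMap (PadicAlgCl 2) ℂ_[2] ((PowerSeries.coeff k (1 : IwasawaAlgebraO S) : ↥(padicCoeffIntegers S)) : PadicAlgCl 2) *
      y ^ k = 1 := by
  rw [tsum_eq_single 0]
  · simp
  · intro k hk
    simp [PowerSeries.coeff_one, hk]

/-! ## §1 Pin linear algebra over the Frobenius datum `(t₀, bO, bO′)` -/

section PinAlgebra

variable {S : Set (PadicAlgCl 2)} (t₀ : ↥(padicCoeffIntegers S) →+ ℤ_[2])
  (ht₀ : ∀ (c : ℤ_[2]) (a : ↥(padicCoeffIntegers S)), t₀ (padicIntToCoeffIntegers S c * a) = c * t₀ a)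
  {nb : ℕ} (bO bO' : Fin nb → ↥(padicCoeffIntegers S))
  (hbO : ∀ a : ↥(padicCoeffIntegers S), a = ∑ i, padicIntToCoeffIntegers S (t₀ (a * bO' i)) * bO i)

include ht₀ hbO in
/-- **Contraction** `t₀(x y) = Σ_j t₀(x bO_j) · t₀(y bO′_j)` (k4-g28's C1 `dualBasis_contraction`, re-proved). [cite: Lang2002, Ch. VI §5 Cor. 5.3] -/
theorem t0_mul_eq_sum (x y : ↥(padicCoeffIntegers S)) :
    t₀ (x * y) = ∑ j, t₀ (x * bO j) * t₀ (y * bO' j) := by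
  conv_lhs => rw [hbO y, Finset.mul_sum]
  rw [map_sum]
  refine Finset.sum_congr rfl fun j _ => ?_
  rw [mul_left_comm, ht₀, mul_comm]

include hbO in
/-- **Expansion in `ℚ̄₂`**: `φ = Σ_j t₀(φ bO′_j) · bO_j`. [cite: Lang2002, Ch. VI §5 Cor. 5.3] -/
theorem coe_eq_sum (φ : ↥(padicCoeffIntegers S)) :
    (φ : PadicAlgCl 2) = ∑ j, algebraMap ℚ_[2] (PadicAlgCl 2) ((t₀ (φ * bO' j) : ℤ_[2]) : ℚ_[2]) * (bO j : PadicAlgCl 2) := by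
  conv_lhs => rw [hbO φ]
  rw [AddSubmonoidClass.coe_finsetSum]
  refine Finset.sum_congr rfl fun j _ => ?_
  rw [Subring.coe_mul, coe_padicIntToCoeffIntegers]

include hbO in
/-- **(D1) Functional representation**: the comparison functionals `ℓ_i : ℚ̄₂ →ₗ[ℚ₂] ℚ₂` are `2^{-s} t₀(c′_i ·)` on `𝒪` with `c′_i ∈ 𝒪`
(one common `2`-power clears the finitely many values `ℓ_i(bO_j) ∈ ℚ₂`; `c′_i := Σ_j 2^s ℓ_i(bO_j) bO′_j`). [cite: Lang2002, Ch. VI §5 Cor. 5.3] -/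
theorem exists_functionalRepr (ht₀ : ∀ (c : ℤ_[2]) (a : ↥(padicCoeffIntegers S)), t₀ (padicIntToCoeffIntegers S c * a) = c * t₀ a)
    {n : ℕ} (ℓ : Fin n → (PadicAlgCl 2 →ₗ[ℚ_[2]] ℚ_[2])) :
    ∃ (s : ℕ) (c' : Fin n → ↥(padicCoeffIntegers S)),
      ∀ (i : Fin n) (a : ↥(padicCoeffIntegers S)),
        (2 : ℚ_[2]) ^ s * ℓ i (a : PadicAlgCl 2) = ((t₀ (c' i * a) : ℤ_[2]) : ℚ_[2]) := by
  choose sij hsij using fun ij : Fin n × Fin nb => exists_pow_half_mul_le ‖ℓ ij.1 (bO ij.2 : PadicAlgCl 2)‖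
  have hint : ∀ (i : Fin n) (j : Fin nb), ‖(2 : ℚ_[2]) ^ (∑ ij, sij ij) * ℓ i (bO j : PadicAlgCl 2)‖ ≤ 1 := by
    intro i j
    rw [norm_mul, norm_pow, norm_two_padic, inv_pow]
    exact hsij (i, j) _ (Finset.single_le_sum (fun x _ => Nat.zero_le (sij x)) (Finset.mem_univ (i, j)))
  refine ⟨∑ ij, sij ij,
    fun i => ∑ j, padicIntToCoeffIntegers S ⟨(2 : ℚ_[2]) ^ (∑ ij, sij ij) * ℓ i (bO j : PadicAlgCl 2), hint i j⟩ * bO' j,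
    fun i a => ?_⟩
  have ha : ℓ i (a : PadicAlgCl 2) = ∑ j, ((t₀ (a * bO' j) : ℤ_[2]) : ℚ_[2]) * ℓ i (bO j : PadicAlgCl 2) := by
    conv_lhs => rw [coe_eq_sum t₀ bO bO' hbO a]
    rw [map_sum]
    refine Finset.sum_congr rfl fun j _ => ?_
    rw [← Algebra.smul_def, map_smul, smul_eq_mul]
  rw [ha, Finset.mul_sum, Finset.sum_mul, map_sum, PadicInt.coe_sum]
  refine Finset.sum_congr rfl fun j _ => ?_
  rw [mul_assoc, ht₀, PadicInt.coe_mul, mul_comm (bO' j) a]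
  push_cast
  ring

/-- **(D2) Common denominators**: finitely many elements of `F_λ = ℚ₂(S)` become integral after one common `2`-power. [folklore] -/
theorem exists_pow_two_mul_eq_coe {L : ℕ} (x : Fin L → PadicAlgCl 2)
    (hx : ∀ k, x k ∈ Literature.NumberTheory.EllipticCurves.padicCoeffField S) :
    ∃ (t : ℕ) (φ : Fin L → ↥(padicCoeffIntegers S)), ∀ k, (2 : PadicAlgCl 2) ^ t * x k = (φ k : PadicAlgCl 2) := by
  choose tk htk using fun k => exists_pow_half_mul_le ‖x k‖
  have hmem : ∀ k, (2 : PadicAlgCl 2) ^ (∑ k, tk k) * x k ∈ padicCoeffIntegers S := by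
    intro k
    rw [Literature.NumberTheory.EllipticCurves.mem_padicCoeffIntegers_iff]
    refine ⟨mul_mem (pow_mem (ofNat_mem _ 2) _) (hx k), ?_⟩
    rw [norm_mul, norm_pow, norm_two_padicAlgCl, inv_pow]
    exact htk k _ (Finset.single_le_sum (fun i _ => Nat.zero_le (tk i)) (Finset.mem_univ k))
  exact ⟨∑ k, tk k, fun k => ⟨_, hmem k⟩, fun k => rfl⟩

end PinAlgebra

/-! ## §2 The dictionary Kato-coordinates ↦ one-pair coordinates, and the three clause transfers -/

section Dictionary

variable {S : Set (PadicAlgCl 2)} (t₀ : ↥(padicCoeffIntegers S) →+ ℤ_[2])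
  (ht₀ : ∀ (c : ℤ_[2]) (a : ↥(padicCoeffIntegers S)), t₀ (padicIntToCoeffIntegers S c * a) = c * t₀ a)
  {nb : ℕ} (bO bO' : Fin nb → ↥(padicCoeffIntegers S))
  (hbO : ∀ a : ↥(padicCoeffIntegers S), a = ∑ i, padicIntToCoeffIntegers S (t₀ (a * bO' i)) * bO i)

/-- `dict s t φ j k := 2^{-s-t} · t₀(φ_k · bO′_j) ∈ ℚ₂` — the `bO`-coordinate `j` of `2^{-s} ι f_{N,k}` (`2^t ι f_{N,k} = φ_k ∈ 𝒪`).
Nothing asserted. [cite: Lang2002, Ch. VI §5 Cor. 5.3] -/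
def dict (s t : ℕ) {L : ℕ} (φ : Fin L → ↥(padicCoeffIntegers S)) (j : Fin nb) (k : Fin L) : ℚ_[2] :=
  ((2 : ℚ_[2]) ^ (s + t))⁻¹ * ((t₀ (φ k * bO' j) : ℤ_[2]) : ℚ_[2])

/-- `wcoord s t φ E N j := Σ_k dict_{N,j,k} · E_{N,k} ∈ ℚ̄₂` — the one-pair value coordinates (`E_{N,k} = e_N(u_{N,k})`). Nothing asserted.
[cite: Kato2004Asterisque, Thm. 12.5 (1) (pp. 221–222)] -/
def wcoord (s : ℕ) {L : ℕ → ℕ} (t : ℕ → ℕ) (φ : ∀ N, Fin (L N) → ↥(padicCoeffIntegers S))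
    (E : ∀ N, Fin (L N) → PadicAlgCl 2) (N : ℕ) (j : Fin nb) : PadicAlgCl 2 :=
  ∑ k, algebraMap ℚ_[2] (PadicAlgCl 2) (dict t₀ bO' s (t N) (φ N) j k) * E N k

variable {n : ℕ} (ℓ : Fin n → (PadicAlgCl 2 →ₗ[ℚ_[2]] ℚ_[2])) (s : ℕ) (c' : Fin n → ↥(padicCoeffIntegers S))
  (hc' : ∀ (i : Fin n) (a : ↥(padicCoeffIntegers S)),
    (2 : ℚ_[2]) ^ s * ℓ i (a : PadicAlgCl 2) = ((t₀ (c' i * a) : ℤ_[2]) : ℚ_[2]))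
  {L : ℕ → ℕ} (x : ∀ N, Fin (L N) → PadicAlgCl 2) (t : ℕ → ℕ) (φ : ∀ N, Fin (L N) → ↥(padicCoeffIntegers S))
  (hφ : ∀ N k, (2 : PadicAlgCl 2) ^ (t N) * x N k = (φ N k : PadicAlgCl 2)) (E : ∀ N, Fin (L N) → PadicAlgCl 2)

include ht₀ hbO hc' hφ in
/-- **Coefficient identity**: `ℓ_i(a · ι f_{N,k}) = Σ_j t₀(c′_i a bO_j) · dict_{N,j,k}` ((D1) ∘ contraction ∘ (D2)). [cite: Lang2002, Ch. VI §5 Cor. 5.3] -/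
theorem ell_mul_eq_sum (N : ℕ) (i : Fin n) (a : ↥(padicCoeffIntegers S)) (k : Fin (L N)) :
    ℓ i ((a : PadicAlgCl 2) * x N k) = ∑ j, ((t₀ (c' i * a * bO j) : ℤ_[2]) : ℚ_[2]) * dict t₀ bO' s (t N) (φ N) j k := by
  have h2t : (2 : PadicAlgCl 2) ^ (t N) ≠ 0 := pow_ne_zero _ two_ne_zero
  have hx : x N k = algebraMap ℚ_[2] (PadicAlgCl 2) (((2 : ℚ_[2]) ^ (t N))⁻¹) * ((φ N k : ↥(padicCoeffIntegers S)) : PadicAlgCl 2) := by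
    rw [map_inv₀, map_pow, map_ofNat, eq_inv_mul_iff_mul_eq₀ h2t, hφ N k]
  have h1 : ℓ i ((a : PadicAlgCl 2) * x N k) =
      ((2 : ℚ_[2]) ^ (t N))⁻¹ * ℓ i ((a * φ N k : ↥(padicCoeffIntegers S)) : PadicAlgCl 2) := by
    rw [hx, mul_left_comm, ← Algebra.smul_def, map_smul, smul_eq_mul, Subring.coe_mul]
  have h2 : ℓ i ((a * φ N k : ↥(padicCoeffIntegers S)) : PadicAlgCl 2) =
      ((2 : ℚ_[2]) ^ s)⁻¹ * ((t₀ (c' i * (a * φ N k)) : ℤ_[2]) : ℚ_[2]) := by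
    rw [eq_inv_mul_iff_mul_eq₀ (pow_ne_zero _ two_ne_zero), hc']
  rw [h1, h2, ← mul_assoc (c' i), t0_mul_eq_sum t₀ ht₀ bO bO' hbO (c' i * a) (φ N k), PadicInt.coe_sum, Finset.mul_sum,
    Finset.mul_sum]
  refine Finset.sum_congr rfl fun j _ => ?_
  rw [PadicInt.coe_mul, dict, pow_add, mul_inv]
  ring

include ht₀ hbO hc' hφ in
/-- **(BK) ⟹ (BKρ) TRANSFER** (pure finite-sum algebra): Kato's right-hand side `Σ_k ℓ_i(a ι f_k) · Σ_b τ_b•(LOG · e(u_k))` equals the one-pair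
right-hand side `Σ_j t₀(c′_i a bO_j) · Σ_b τ_b•(LOG · w_j)` — constants outside the Galois sums, `τ_b` fixes `ℚ₂`.
[cite: Kato2004Asterisque, Thm. 12.5 (1) (pp. 221–222)] [cite: BlochKato1990, §3 (3.10.1), (3.11)] -/
theorem bk_transfer {B : Type*} [Fintype B] (τb : B → absoluteGaloisGroup ℚ_[2]) (LOG : PadicAlgCl 2) (N : ℕ) (i : Fin n)
    (a : ↥(padicCoeffIntegers S)) :
    ∑ k, algebraMap ℚ_[2] (PadicAlgCl 2) (ℓ i ((a : PadicAlgCl 2) * x N k)) * ∑ b, τb b • (LOG * E N k) =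
      ∑ j, algebraMap ℚ_[2] (PadicAlgCl 2) ((t₀ (c' i * a * bO j) : ℤ_[2]) : ℚ_[2]) *
        ∑ b, τb b • (LOG * wcoord t₀ bO' s t φ E N j) := by
  have hR : ∀ (j : Fin nb) (b : B), τb b • (LOG * wcoord t₀ bO' s t φ E N j) =
      ∑ k, algebraMap ℚ_[2] (PadicAlgCl 2) (dict t₀ bO' s (t N) (φ N) j k) * (τb b • LOG * τb b • E N k) := by
    intro j b
    rw [wcoord, smul_mul', Finset.smul_sum, Finset.mul_sum]
    refine Finset.sum_congr rfl fun k _ => ?_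
    rw [smul_mul', smul_algebraMap]
    ring
  have hL : ∀ (k : Fin (L N)) (b : B), τb b • (LOG * E N k) = τb b • LOG * τb b • E N k := fun k b => smul_mul' _ _ _
  simp_rw [hR, hL, ell_mul_eq_sum t₀ ht₀ bO bO' hbO ℓ s c' hc' x t φ hφ N i a, map_sum, map_mul, Finset.sum_mul, Finset.mul_sum]
  rw [Finset.sum_comm]
  refine Finset.sum_congr rfl fun j _ => ?_
  rw [Finset.sum_comm]
  refine Finset.sum_congr rfl fun b _ => Finset.sum_congr rfl fun k _ => ?_
  ring

include hbO hφ in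
/-- **Recombination** `Σ_j bO_j · dict_{N,j,k} = 2^{-s} ι f_{N,k}`. [cite: Lang2002, Ch. VI §5 Cor. 5.3] -/
theorem sum_coe_mul_dict (N : ℕ) (k : Fin (L N)) :
    ∑ j, (bO j : PadicAlgCl 2) * algebraMap ℚ_[2] (PadicAlgCl 2) (dict t₀ bO' s (t N) (φ N) j k) =
      ((2 : PadicAlgCl 2) ^ s)⁻¹ * x N k := by
  have h2t : (2 : PadicAlgCl 2) ^ (t N) ≠ 0 := pow_ne_zero _ two_ne_zero
  have hx : x N k = ((2 : PadicAlgCl 2) ^ (t N))⁻¹ * ((φ N k : ↥(padicCoeffIntegers S)) : PadicAlgCl 2) := by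
    rw [eq_inv_mul_iff_mul_eq₀ h2t, hφ N k]
  rw [hx, coe_eq_sum t₀ bO bO' hbO (φ N k), Finset.mul_sum, Finset.mul_sum]
  refine Finset.sum_congr rfl fun j _ => ?_
  rw [dict, map_mul, map_inv₀, map_pow, map_ofNat, pow_add, mul_inv]
  ring

include hbO hφ in
/-- **(VAL) ⟹ (VALρ) TRANSFER** (pure finite-sum algebra): `Σ_j bO_j Σ_b ψ_b τ_b•w_{N,j} = 2^{-s} Σ_k ι f_{N,k} Σ_b ψ_b τ_b•E_{N,k}`.
[cite: Kato2004Asterisque, Thm. 12.5 (1) (pp. 221–222), (5.7.1) (p. 157)] -/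
theorem val_transfer {B : Type*} [Fintype B] (τb : B → absoluteGaloisGroup ℚ_[2]) (ψi : B → PadicAlgCl 2) (N : ℕ) :
    ∑ j, (bO j : PadicAlgCl 2) * ∑ b, ψi b * τb b • wcoord t₀ bO' s t φ E N j =
      ((2 : PadicAlgCl 2) ^ s)⁻¹ * ∑ k, x N k * ∑ b, ψi b * τb b • E N k := by
  have hτ : ∀ (j : Fin nb) (b : B), τb b • wcoord t₀ bO' s t φ E N j =
      ∑ k, algebraMap ℚ_[2] (PadicAlgCl 2) (dict t₀ bO' s (t N) (φ N) j k) * τb b • E N k := by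
    intro j b
    rw [wcoord, Finset.smul_sum]
    refine Finset.sum_congr rfl fun k _ => ?_
    rw [smul_mul', smul_algebraMap]
  calc ∑ j, (bO j : PadicAlgCl 2) * ∑ b, ψi b * τb b • wcoord t₀ bO' s t φ E N j
      = ∑ j, ∑ k, ∑ b, (bO j : PadicAlgCl 2) * algebraMap ℚ_[2] (PadicAlgCl 2) (dict t₀ bO' s (t N) (φ N) j k) *
          (ψi b * τb b • E N k) := by
        refine Finset.sum_congr rfl fun j _ => ?_
        simp_rw [hτ, Finset.mul_sum]
        rw [Finset.sum_comm]
        refine Finset.sum_congr rfl fun k _ => Finset.sum_congr rfl fun b _ => ?_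
        ring
    _ = ∑ k, (∑ j, (bO j : PadicAlgCl 2) * algebraMap ℚ_[2] (PadicAlgCl 2) (dict t₀ bO' s (t N) (φ N) j k)) *
          ∑ b, ψi b * τb b • E N k := by
        rw [Finset.sum_comm]
        refine Finset.sum_congr rfl fun k _ => ?_
        rw [Finset.sum_mul]
        refine Finset.sum_congr rfl fun j _ => ?_
        rw [Finset.mul_sum]
    _ = ((2 : PadicAlgCl 2) ^ s)⁻¹ * ∑ k, x N k * ∑ b, ψi b * τb b • E N k := by
        simp_rw [sum_coe_mul_dict t₀ bO bO' hbO s x t φ hφ N]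
        rw [Finset.mul_sum]
        refine Finset.sum_congr rfl fun k _ => ?_
        ring

include hbO hφ in
/-- **(TRIV) ⟹ (TRIVρ) TRANSFER**: `val_transfer` at the trivial weight. [cite: Kato2004Asterisque, Thm. 12.5 (1) (pp. 221–222)] -/
theorem triv_transfer {B : Type*} [Fintype B] (τb : B → absoluteGaloisGroup ℚ_[2]) (N : ℕ) :
    ∑ j, (bO j : PadicAlgCl 2) * ∑ b, τb b • wcoord t₀ bO' s t φ E N j =
      ((2 : PadicAlgCl 2) ^ s)⁻¹ * ∑ k, x N k * ∑ b, τb b • E N k := by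
  have h := val_transfer t₀ bO bO' hbO s x t φ hφ E τb (fun _ => 1) N
  simpa only [one_mul] using h

end Dictionary

/-! ## §3⁰ The frame of the fact from a `KatoFrame` (statement = w3's landed `OnePair.ChildA.exists_cyclotomicFrame`, p728621; re-proved
here only to keep this scratch file independent of a module the farm has not cached yet) -/

/-- A coherent tower `e_k : ℚ(ζ_{2^k}) →ₐ[ℚ] ℚ̄₂`, `e_k(ζ_{2^k}) = zeta 2 k`, on which the frame's lifts act by powers (TP2's
`KatoValue.exists_ringHom_zeta_eq_padicZeta`, coherence `zeta_succ_pow`). Same statement as `OnePair.ChildA.exists_cyclotomicFrame` (use THAT by name).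
[cite: Washington1997, Ch. 2 Thm. 2.5] [cite: Kobayashi2003, §8.4] -/
theorem exists_algHom_tower (τ : ∀ m : ℕ, ZMod (2 ^ m) → Field.absoluteGaloisGroup ℚ_[2])
    (hτ : ∀ (m : ℕ) (a : ZMod (2 ^ m)), IsUnit a → τ m a • zeta 2 m = zeta 2 m ^ a.val) :
    ∃ e : ∀ k : ℕ, CyclotomicField (2 ^ k) ℚ →ₐ[ℚ] PadicAlgCl 2,
      (∀ k, e k (IsCyclotomicExtension.zeta (2 ^ k) ℚ (CyclotomicField (2 ^ k) ℚ)) = zeta 2 k) ∧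
      (∀ k, e (k + 1) (IsCyclotomicExtension.zeta (2 ^ (k + 1)) ℚ (CyclotomicField (2 ^ (k + 1)) ℚ)) ^ 2 =
        e k (IsCyclotomicExtension.zeta (2 ^ k) ℚ (CyclotomicField (2 ^ k) ℚ))) ∧
      (∀ (k : ℕ) (a : ZMod (2 ^ k)), IsUnit a →
        τ k a • e k (IsCyclotomicExtension.zeta (2 ^ k) ℚ (CyclotomicField (2 ^ k) ℚ)) =
          e k (IsCyclotomicExtension.zeta (2 ^ k) ℚ (CyclotomicField (2 ^ k) ℚ)) ^ a.val) := by
  have key : ∀ k : ℕ, ∃ e : CyclotomicField (2 ^ k) ℚ →ₐ[ℚ] PadicAlgCl 2,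
      e (IsCyclotomicExtension.zeta (2 ^ k) ℚ (CyclotomicField (2 ^ k) ℚ)) = zeta 2 k := by
    intro k
    obtain ⟨e, he⟩ := KatoValue.exists_ringHom_zeta_eq_padicZeta 2 k (m := 2 ^ k) rfl
    exact ⟨e.toRatAlgHom, he⟩
  choose e he using key
  refine ⟨e, he, fun k => ?_, fun k a ha => ?_⟩
  · rw [he, he]; exact zeta_succ_pow 2 k
  · rw [he]; exact hτ k a ha

/-! ## §3 THE POINTWISE PORT (z FIXED): Kato's witnesses and clauses at the pins ⟹ the one-pair valued class OF THE SAME `z` -/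

set_option maxHeartbeats 1600000 in
/-- **POINTWISE CHILD-A PORT, `z` FIXED (the decomposition the MERGED child-AB successor needs).** In the registered telescope of
`OnePair.stub_kzgChildA` (onepair.lean v3h l.105–107, bytes VERBATIM up to `∀ (F : π.KatoFrame),`), for every frame tower `e_k : ℚ(ζ_{2^k}) →ₐ ℚ̄₂`
with `e_k(ζ_{2^k}) = zeta 2 k` (w3's `ChildA.exists_cyclotomicFrame`) and EVERY Kato witness `(z, ℓ, L, f, u, r)` satisfying the four clauses of
`Kato2004.exists_zetaElement_newform_tatePairing_values_two` INSTANTIATED at `(π, F, e)` (texts = the fact's l.262–304 with `v ↦ π.v`, `pair ↦ π.pair`,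
`Φ ↦ F.Φ`, `τ ↦ F.τ`, `hζc N ↦ zeta_spec`), there are `c′ w q` with `π.KatoValuedClass g ι Ω F.Φ F.τ z c′ w q 1` — FOR THAT `z`, slack modulus `μt = 1` EXPLICIT (so the child-B
adapter may use `λ(Λ/(1)) = 0`).
(w3's landed `katoValuedClass_of_zetaElement` p728621 consumes the fact as an opaque `Prop` and hides `z` under `∃`; a merged successor fact
«Kato125AB» = same `∃ z …` with child-B conjuncts appended (S165) ports through THIS theorem with `z` shared.) Kernel glue over hypotheses; nothing
asserted about any curve or form; BSD not proved. [cite: Kato2004Asterisque, Thm. 12.5 (1) (pp. 221–222), §15.16 (p. 265)] [cite: BlochKato1990, §3 (3.10.1), (3.11)] -/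
theorem katoValuedClass_of_katoWitness :
    open Literature.NumberTheory.EllipticCurves GreenbergSelmer GreenbergVatsal2000 Kobayashi2003 ModularForms Rank1Residual Literature.NumberTheory.GaloisRepresentations Literature.NumberTheory.Automorphic IsDedekindDomain NumberField Field Rat.HeightOneSpectrum PowerSeries Summit.BirchSwinnertonDyer.BirchSwinnertonDyer.Theorems.OnePair in ∀ (W : WeierstrassCurve ℚ) [W.IsElliptic] [W.IsGloballyMinimal], ¬ W.HasCM → W.analyticRank = 0 → GoodSS W 2 → W.frobeniusTrace 2 = 0 → W.Δ < 0 → ∀ (M : ℕ) [NeZero M] (g : CuspForm (CongruenceSubgroup.Gamma0 M) 2) (ι : coeffField g →+* PadicAlgCl 2) (Ω : ℂ), Odd M → IsNewform0 g → IsCMForm (liftToGamma1 M 2 g) → cuspCoeff g 2 = 0 → IsCohomologicalPlusPeriod g ι Ω → (∀ ℓ : ℕ, ℓ.Prime → ¬ ℓ ∣ 2 * M * W.conductorNorm ℤ → ‖embCoeff g ι ℓ - (W.frobeniusTrace ℓ : PadicAlgCl 2)‖ < 1) → ∀ (κ : ZpExtension ℚ 2) (γ : absoluteGaloisGroup ℚ),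 κ.IsCyclotomic → κ.IsTopGenerator γ → IsCyclotomicVariable 2 γ → ∀ (S₀ : Finset (HeightOneSpectrum (RingOfIntegers ℚ))), (∀ v ∈ S₀, ((2 : ℕ) : RingOfIntegers ℚ) ∉ v.asIdeal) → (∀ v, ¬ W.HasGoodReductionAt v → v ∈ S₀) → (∀ v, natGenerator v ∣ M → v ∈ S₀) → ∀ (Lp Lm : IwasawaAlgebraO (Set.range ι)) (d : ℕ), IsPollackPairK g ι Ω Lp Lm → (∀ k, ‖coeff k (iwasawaOToPowerSeries (Set.range ι) Lm)‖ ≤ ‖coeff d (iwasawaOToPowerSeries (Set.range ι) Lm)‖) → (∀ k < d, ‖coeff k (iwasawaOToPowerSeries (Set.range ι) Lm)‖ < ‖coeff d (iwasawaOToPowerSeries (Set.range ι) Lm)‖) → ∀ (n : ℕ) (ρ : FramedGaloisRep ℚ (coeffO (Set.range ι)) 2) (Θ : ∀ v : HeightOneSpectrum (RingOfIntegers ℚ), ((2 : ℕ) : RingOfIntegers ℚ) ∈ v.asIdeal → (CofreeF (Set.range ι) ρ ≃+ (Fin n → ↥(W.geomPrimaryTorsion 2)))), (∀ v, ¬ natGenerator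 v ∣ 2 * M → ρ.IsUnramifiedAt v ∧ ∃ P : Polynomial (coeffO (Set.range ι)), P.map (padicCoeffIntegers (Set.range ι)).subtype = Polynomial.X ^ 2 - Polynomial.C (embCoeff g ι (natGenerator v)) * Polynomial.X + Polynomial.C ((natGenerator v : ℕ) : PadicAlgCl 2) ∧ ρ.HasFrobCharpolyAt v P) → ∀ (hΘ : ∀ v hv (δ : absoluteGaloisGroup (v.adicCompletion ℚ)) m i, Θ v hv (resGalOfEmb (closureEmb (K := ℚ) (v.adicCompletion ℚ)) δ • m) i = resGalOfEmb (closureEmb (K := ℚ) (v.adicCompletion ℚ)) δ • Θ v hv m i), ∀ (ϖ : (coeffO (Set.range ι))), Irreducible ϖ → ∀ (Sg : AddSubgroup (H1Γ (Set.range ι) κ ρ)) [Module (coeffO (Set.range ι)) ↥Sg], (∀ (a : (coeffO (Set.range ι))) (s : ↥Sg), ((a • s : ↥Sg) : H1Γ (Set.range ι) κ ρ) = scalarH1 κ.kerSubgroup (CofreeF (Set.range ι) ρ) a s) → (∀ y : H1Γ (Set.range ι) κ ρ, y ∈ Sg ↔ y ∈ plusSelmerSet (Set.range ι) W κ S₀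 n ρ Θ) → (∀ (τ : absoluteGaloisGroup ℚ) (y : H1Γ (Set.range ι) κ ρ), y ∈ Sg → conjH1 κ.kerSubgroup (CofreeF (Set.range ι) ρ) τ y ∈ Sg) → (plusSelmerTorsionSet (Set.range ι) W κ S₀ n ρ Θ ϖ).Finite → ∀ (I : Kato2004.IwasawaH1DataCoeff (FramedGaloisRep.toGaloisRep ρ) 2 κ γ) [Module (coeffO (Set.range ι)) I.H] [IsScalarTower (coeffO (Set.range ι)) (IwasawaAlgebraO (Set.range ι)) I.H], (∀ (a : (coeffO (Set.range ι))) (x : I.H), a • x = (PowerSeries.C a : IwasawaAlgebraO (Set.range ι)) • x) → ∀ (π : OnePairPins (Set.range ι) W κ γ S₀ n ρ Θ hΘ I Sg), ∀ (F : π.KatoFrame),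
      ∀ (e : ∀ k : ℕ, CyclotomicField (2 ^ k) ℚ →ₐ[ℚ] PadicAlgCl 2),
        (∀ k : ℕ, e k (IsCyclotomicExtension.zeta (2 ^ k) ℚ (CyclotomicField (2 ^ k) ℚ)) =
          Summit.BirchSwinnertonDyer.Rank1Residual.Additive.PadicCyclotomicTower.zeta 2 k) →
      ∀ (z : I.H) (ℓ : Fin n → (PadicAlgCl 2 →ₗ[ℚ_[2]] ℚ_[2])) (L : ℕ → ℕ)
        (f : ∀ N : ℕ, Fin (L N) → coeffField g) (u : ∀ N : ℕ, Fin (L N) → CyclotomicField (2 ^ N) ℚ) (r : coeffField g),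
        r ≠ 0 →
        -- (ND) Kato's comparison functionals separate `𝒪`
        Function.Injective (fun (a : coeffO (Set.range ι)) (i : Fin n) => ℓ i (a : PadicAlgCl 2)) →
        -- (BK) at the pins `(π.v, π.pair)` and the frame `(F.Φ, e, F.τ)`
        (∀ (a : coeffO (Set.range ι)) (m : ℕ) (i : Fin n) (Q₀ : localPoints W ℚ_[2])
          (hQv : WeierstrassCurve.Affine.Point.map (W' := W)
              (F.Φ : AlgebraicClosure ℚ_[2] →ₐ[ℚ] AlgebraicClosure ((π.v).adicCompletion ℚ))
              (show (W.baseChange (AlgebraicClosure ℚ_[2])).toAffine.Point from Q₀) ∈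
            localLayerPointsOfEmb κ (closureEmb (K := ℚ) ((π.v).adicCompletion ℚ)) W m),
          (∀ (X Y : AlgebraicClosure ℚ_[2]) (hXY : (W.baseChange (AlgebraicClosure ℚ_[2])).toAffine.Nonsingular X Y),
              (show (W.baseChange (AlgebraicClosure ℚ_[2])).toAffine.Point from Q₀) = .some X Y hXY → 1 < Valued.v X) →
          algebraMap ℚ_[2] (PadicAlgCl 2)
              ((π.pair m (I.proj m ((PowerSeries.C (a : coeffO (Set.range ι)) :
                  IwasawaAlgebraO (Set.range ι)) • z)) (Pi.single i ⟨_, hQv⟩) : ℤ_[2]) : ℚ_[2]) =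
            ∑ k : Fin (L (m + 2)), algebraMap ℚ_[2] (PadicAlgCl 2) (ℓ i ((a : PadicAlgCl 2) * ι (f (m + 2) k))) *
              ∑ b : (ZMod (2 ^ (m + 2)))ˣ, F.τ (m + 2) (b : ZMod (2 ^ (m + 2))) •
                ((∑' j : ℕ, algebraMap ℚ_[2] (PadicAlgCl 2) (PowerSeries.coeff j (W.map (algebraMap ℚ ℚ_[2])).formalLog) *
                    (WeierstrassCurve.Affine.Point.zCoord
                      (show (W.baseChange (AlgebraicClosure ℚ_[2])).toAffine.Point from Q₀)) ^ j) *
                  e (m + 2) (u (m + 2) k))) →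
        -- (VAL) in every realisation `(R, s₁, s₂)`, Gauss sums at the cyclotomic roots `ζ_{2^N}`
        (∀ (N : ℕ), 2 ≤ N → ∀ (R : Type) [Field R] (s₁ : coeffField g →+* R) (s₂ : CyclotomicField (2 ^ N) ℚ →+* R)
          (χ : DirichletCharacter R (2 ^ N)), χ (-1) = 1 → χ.IsPrimitive →
          (∑ k : Fin (L N), s₁ (f N k) *
              ∑ b : (ZMod (2 ^ N))ˣ, χ⁻¹ (b : ZMod (2 ^ N)) * s₂ (Kato2004.EulerSystemValues.sigma (2 ^ N) b (u N k))) *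
            gaussSum χ (AddChar.zmodChar (2 ^ N)
              ((IsCyclotomicExtension.zeta_spec (2 ^ N) ℚ (CyclotomicField (2 ^ N) ℚ)).map_of_injective
                s₂.injective).pow_eq_one) =
          s₁ r * ∑ a : ZMod (2 ^ N), χ a * s₁ (plusSymbolK g Ω ((a.val : ℚ) / (2 : ℚ) ^ N))) →
        -- (TRIV) the `2`-depleted central value at every level `2^N`, `N ≥ 2`
        (∀ (N : ℕ), 2 ≤ N → ∀ (R : Type) [Field R] (s₁ : coeffField g →+* R) (s₂ : CyclotomicField (2 ^ N) ℚ →+* R),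
          2 * ∑ k : Fin (L N), s₁ (f N k) * ∑ b : (ZMod (2 ^ N))ˣ, s₂ (Kato2004.EulerSystemValues.sigma (2 ^ N) b (u N k)) =
            s₁ r * (2 - s₁ ⟨cuspCoeff g 2, coeff_mem_coeffField g 2⟩ + (if 2 ∣ M then 0 else 1)) *
              s₁ (plusSymbolK g Ω 0)) →
        ∃ (c' : Fin n → coeffO (Set.range ι)) (w : ℕ → Fin π.nb → PadicAlgCl 2) (q : PadicAlgCl 2),
          π.KatoValuedClass g ι Ω F.Φ F.τ z c' w q 1 := by
  intro W _ _ hcm hr hss ha hΔ M _ g ι Ω hM hg hcmg hg2 hΩ hcong κ γ hκ hγ hvar S₀ hS₀a hS₀b hS₀c Lp Lm d hPol hLm₁ hLm₂ n ρ Θ hfrob hΘ ϖ hϖ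
    Sg _ hSg₁ hSg₂ hSg₃ hfin I _ _ hIC π F e he z ℓ L f u r hr0 hND hBK hVAL hTRIV
  -- the frame as ring maps, pinned at the tree's tower
  have he' : ∀ k : ℕ, (e k : CyclotomicField (2 ^ k) ℚ →+* PadicAlgCl 2)
      (IsCyclotomicExtension.zeta (2 ^ k) ℚ (CyclotomicField (2 ^ k) ℚ)) = zeta 2 k := he
  -- (D) the pin dictionary
  obtain ⟨s, c', hc'⟩ := exists_functionalRepr π.t₀ π.bO π.bO' π.hbO π.ht₀ ℓ
  have hden : ∀ N : ℕ, ∃ (tN : ℕ) (φN : Fin (L N) → coeffO (Set.range ι)),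
      ∀ k, (2 : PadicAlgCl 2) ^ tN * ι (f N k) = (φN k : PadicAlgCl 2) :=
    fun N => exists_pow_two_mul_eq_coe (fun k => ι (f N k))
      (fun k => IntermediateField.subset_adjoin ℚ_[2] (Set.range ι) ⟨f N k, rfl⟩)
  choose t φ hφ using hden
  refine ⟨c', wcoord π.t₀ π.bO' s t φ (fun N k => e N (u N k)), ((2 : PadicAlgCl 2) ^ s)⁻¹ * ι r,
    ?_, one_ne_zero, ?_, ?_, ?_, ?_⟩
  · -- `q ≠ 0`
    exact mul_ne_zero (inv_ne_zero (pow_ne_zero _ two_ne_zero)) ((map_ne_zero ι).mpr hr0)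
  · -- (ND)
    intro a b hab
    apply hND
    funext i
    have h : π.t₀ (c' i * a) = π.t₀ (c' i * b) := congrFun hab i
    have h2 : (2 : ℚ_[2]) ^ s * ℓ i (a : PadicAlgCl 2) = (2 : ℚ_[2]) ^ s * ℓ i (b : PadicAlgCl 2) := by
      rw [hc', hc', h]
    exact mul_left_cancel₀ (pow_ne_zero s two_ne_zero) h2
  · -- (BKρ): TP2's log bridge by name, then `bk_transfer`
    haveI := isIntegral_genFib_baseChange 2 ((WeierstrassCurve.integralModelInt W).map (Int.castRingHom ℤ_[2]))
    intro a m i Q₀ hQv hker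
    have hker' := (toLoc_symm_mem_kernel_iff (W := W)
      ((genFibΩ_eq_baseChange ((WeierstrassCurve.integralModelInt W).map (Int.castRingHom ℤ_[2]))).trans
        (baseChange_twoAdicModel W)) Q₀).mp hker
    rw [KatoBK.ptLogΩ_toLoc_symm_eq, hBK a m i Q₀ hQv hker']
    exact bk_transfer π.t₀ π.ht₀ π.bO π.bO' π.hbO ℓ s c' hc' (fun N k => ι (f N k)) t φ hφ (fun N k => e N (u N k))
      (fun b : (ZMod (2 ^ (m + 2)))ˣ => F.τ (m + 2) (b : ZMod (2 ^ (m + 2)))) _ (m + 2) i a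
  · -- (VALρ): Kato's (VAL) in the realisation `(ℚ̄₂, ι, e_{m+2})`, `e ∘ σ_b = τ_b • e`, Gauss-sum roots agree, then `val_transfer`
    intro m ψ hψ hprim
    have hV := hVAL (m + 2) (by omega) (PadicAlgCl 2) ι (e (m + 2) : CyclotomicField (2 ^ (m + 2)) ℚ →+* PadicAlgCl 2) ψ hψ hprim
    have hσ : ∀ (b : (ZMod (2 ^ (m + 2)))ˣ) (y : CyclotomicField (2 ^ (m + 2)) ℚ),
        (e (m + 2) : CyclotomicField (2 ^ (m + 2)) ℚ →+* PadicAlgCl 2) (Kato2004.EulerSystemValues.sigma (2 ^ (m + 2)) b y) =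
          F.τ (m + 2) (b : ZMod (2 ^ (m + 2))) • e (m + 2) y :=
      fun b y => KatoValue.map_sigma_eq_smul (e (m + 2) : CyclotomicField (2 ^ (m + 2)) ℚ →+* PadicAlgCl 2) (he' (m + 2))
        (F.τ (m + 2) (b : ZMod (2 ^ (m + 2)))) b (F.hτ (m + 2) _ (Units.isUnit b)) y
    have hroot : AddChar.zmodChar (2 ^ (m + 2))
        (((IsCyclotomicExtension.zeta_spec (2 ^ (m + 2)) ℚ (CyclotomicField (2 ^ (m + 2)) ℚ)).map_of_injective
          (e (m + 2) : CyclotomicField (2 ^ (m + 2)) ℚ →+* PadicAlgCl 2).injective).pow_eq_one) =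
        AddChar.zmodChar (2 ^ (m + 2)) (HondaLog.zeta_pow_prime_pow_self (p := 2) (m + 2)) :=
      zmodChar_congr_root (he' (m + 2)) _ _
    simp_rw [hσ] at hV
    rw [hroot] at hV
    have hW := val_transfer π.t₀ π.bO π.bO' π.hbO s (fun N k => ι (f N k)) t φ hφ (fun N k => e N (u N k))
      (fun b : (ZMod (2 ^ (m + 2)))ˣ => F.τ (m + 2) (b : ZMod (2 ^ (m + 2))))
      (fun b : (ZMod (2 ^ (m + 2)))ˣ => ψ⁻¹ (b : ZMod (2 ^ (m + 2)))) (m + 2)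
    beta_reduce at hW
    rw [hW, mul_assoc, hV, tsum_coeff_one_mul_pow, mul_one, ← map_mul, mul_assoc]
  · -- (TRIVρ): Kato's (TRIV) at `a₂(g) = 0`, `M` odd (Euler factor `3/2`), then `triv_transfer`
    intro k hk2 hk3
    have hT := hTRIV k hk2 (PadicAlgCl 2) ι (e k : CyclotomicField (2 ^ k) ℚ →+* PadicAlgCl 2)
    have hσ : ∀ (b : (ZMod (2 ^ k))ˣ) (y : CyclotomicField (2 ^ k) ℚ),
        (e k : CyclotomicField (2 ^ k) ℚ →+* PadicAlgCl 2) (Kato2004.EulerSystemValues.sigma (2 ^ k) b y) =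
          F.τ k (b : ZMod (2 ^ k)) • e k y :=
      fun b y => KatoValue.map_sigma_eq_smul (e k : CyclotomicField (2 ^ k) ℚ →+* PadicAlgCl 2) (he' k)
        (F.τ k (b : ZMod (2 ^ k))) b (F.hτ k _ (Units.isUnit b)) y
    simp_rw [hσ] at hT
    have ha2 : (⟨cuspCoeff g 2, coeff_mem_coeffField g 2⟩ : coeffField g) = 0 := Subtype.ext hg2
    rw [ha2, map_zero, if_neg (Odd.not_two_dvd_nat hM)] at hT
    have hW := triv_transfer π.t₀ π.bO π.bO' π.hbO s (fun N k => ι (f N k)) t φ hφ (fun N k => e N (u N k))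
      (fun b : (ZMod (2 ^ k))ˣ => F.τ k (b : ZMod (2 ^ k))) k
    beta_reduce at hW
    have hcf : (((PowerSeries.coeff 0 (1 : IwasawaAlgebraO (Set.range ι))) : coeffO (Set.range ι)) : PadicAlgCl 2) = 1 := by simp
    rw [hW, hcf]
    linear_combination (((2 : PadicAlgCl 2) ^ s)⁻¹ / 2) * hT

/-! ## §4 CHECK OF THE CUT: child A (∃-hidden, registered text VERBATIM) = fact instantiation + w3's frame + the pointwise port -/

set_option maxHeartbeats 1600000 in
/-- **Child A re-derived through the cut** (same statement as w3's landed `OnePair.stub_kzgChildA_of_zetaElement`, p728621 — here only to CHECK in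
kernel that `katoValuedClass_of_katoWitness`'s hand-instantiated clause texts ARE the fact's clauses at the pins, by `exact`): the registered text of
`stub_kzgChildA` VERBATIM from the named fact. Hypothesis = the fact; nothing asserted; BSD not proved.
[cite: Kato2004Asterisque, Thm. 12.5 (1) (pp. 221–222)] -/
theorem stub_kzgChildA_of_fact (hK : Kato2004.exists_zetaElement_newform_tatePairing_values_two) :
    open Literature.NumberTheory.EllipticCurves GreenbergSelmer GreenbergVatsal2000 Kobayashi2003 ModularForms Rank1Residual Literature.NumberTheory.GaloisRepresentations Literature.NumberTheory.Automorphic IsDedekindDomain NumberField Field Rat.HeightOneSpectrum PowerSeries Summit.BirchSwinnertonDyer.BirchSwinnertonDyer.Theorems.OnePair in ∀ (W : WeierstrassCurve ℚ) [W.IsElliptic] [W.IsGloballyMinimal], ¬ W.HasCM → W.analyticRank = 0 → GoodSS W 2 → W.frobeniusTrace 2 = 0 → W.Δ < 0 → ∀ (M : ℕ) [NeZero M] (g : CuspForm (CongruenceSubgroup.Gamma0 M) 2) (ι : coeffField g →+* PadicAlgCl 2) (Ω : ℂ), Odd M → IsNewform0 g → IsCMForm (liftToGamma1 M 2 g) →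 cuspCoeff g 2 = 0 → IsCohomologicalPlusPeriod g ι Ω → (∀ ℓ : ℕ, ℓ.Prime → ¬ ℓ ∣ 2 * M * W.conductorNorm ℤ → ‖embCoeff g ι ℓ - (W.frobeniusTrace ℓ : PadicAlgCl 2)‖ < 1) → ∀ (κ : ZpExtension ℚ 2) (γ : absoluteGaloisGroup ℚ), κ.IsCyclotomic → κ.IsTopGenerator γ → IsCyclotomicVariable 2 γ → ∀ (S₀ : Finset (HeightOneSpectrum (RingOfIntegers ℚ))), (∀ v ∈ S₀, ((2 : ℕ) : RingOfIntegers ℚ) ∉ v.asIdeal) → (∀ v, ¬ W.HasGoodReductionAt v → v ∈ S₀) → (∀ v, natGenerator v ∣ M → v ∈ S₀) → ∀ (Lp Lm : IwasawaAlgebraO (Set.range ι)) (d : ℕ), IsPollackPairK g ι Ω Lp Lm → (∀ k, ‖coeff k (iwasawaOToPowerSeries (Set.range ι) Lm)‖ ≤ ‖coeff d (iwasawaOToPowerSeries (Set.range ι) Lm)‖) → (∀ k < d, ‖coeff k (iwasawaOToPowerSeries (Set.range ι) Lm)‖ < ‖coeff d (iwasawaOToPowerSeries (Set.range ι) Lm)‖)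 → ∀ (n : ℕ) (ρ : FramedGaloisRep ℚ (coeffO (Set.range ι)) 2) (Θ : ∀ v : HeightOneSpectrum (RingOfIntegers ℚ), ((2 : ℕ) : RingOfIntegers ℚ) ∈ v.asIdeal → (CofreeF (Set.range ι) ρ ≃+ (Fin n → ↥(W.geomPrimaryTorsion 2)))), (∀ v, ¬ natGenerator v ∣ 2 * M → ρ.IsUnramifiedAt v ∧ ∃ P : Polynomial (coeffO (Set.range ι)), P.map (padicCoeffIntegers (Set.range ι)).subtype = Polynomial.X ^ 2 - Polynomial.C (embCoeff g ι (natGenerator v)) * Polynomial.X + Polynomial.C ((natGenerator v : ℕ) : PadicAlgCl 2) ∧ ρ.HasFrobCharpolyAt v P) → ∀ (hΘ : ∀ v hv (δ : absoluteGaloisGroup (v.adicCompletion ℚ)) m i, Θ v hv (resGalOfEmb (closureEmb (K := ℚ) (v.adicCompletion ℚ)) δ • m) i = resGalOfEmb (closureEmb (K := ℚ) (v.adicCompletion ℚ)) δ • Θ v hv m i), ∀ (ϖ : (coeffO (Set.range ι))), Irreducible ϖ → ∀ (Sg : AddSubgroup (H1Γ (Set.range ι) κ ρ)) [Module (coeffO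 (Set.range ι)) ↥Sg], (∀ (a : (coeffO (Set.range ι))) (s : ↥Sg), ((a • s : ↥Sg) : H1Γ (Set.range ι) κ ρ) = scalarH1 κ.kerSubgroup (CofreeF (Set.range ι) ρ) a s) → (∀ y : H1Γ (Set.range ι) κ ρ, y ∈ Sg ↔ y ∈ plusSelmerSet (Set.range ι) W κ S₀ n ρ Θ) → (∀ (τ : absoluteGaloisGroup ℚ) (y : H1Γ (Set.range ι) κ ρ), y ∈ Sg → conjH1 κ.kerSubgroup (CofreeF (Set.range ι) ρ) τ y ∈ Sg) → (plusSelmerTorsionSet (Set.range ι) W κ S₀ n ρ Θ ϖ).Finite → ∀ (I : Kato2004.IwasawaH1DataCoeff (FramedGaloisRep.toGaloisRep ρ) 2 κ γ) [Module (coeffO (Set.range ι)) I.H] [IsScalarTower (coeffO (Set.range ι)) (IwasawaAlgebraO (Set.range ι)) I.H], (∀ (a : (coeffO (Set.range ι))) (x : I.H), a • x = (PowerSeries.C a : IwasawaAlgebraO (Set.range ι)) • x) → ∀ (π : OnePairPins (Set.range ι) W κ γ S₀ n ρ Θ hΘ I Sg), ∀ (F : π.KatoFrame), ∃ (z : I.H)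 (c' : Fin n → coeffO (Set.range ι)) (w : ℕ → Fin π.nb → PadicAlgCl 2) (q : PadicAlgCl 2) (μt : IwasawaAlgebraO (Set.range ι)), π.KatoValuedClass g ι Ω F.Φ F.τ z c' w q μt := by
  intro W _ _ hcm hr hss ha hΔ M _ g ι Ω hM hg hcmg hg2 hΩ hcong κ γ hκ hγ hvar S₀ hS₀a hS₀b hS₀c Lp Lm d hPol hLm₁ hLm₂ n ρ Θ hfrob hΘ ϖ hϖ
    Sg _ hSg₁ hSg₂ hSg₃ hfin I _ _ hIC π F
  -- the frame of the fact from `F` (same statement as w3's landed `OnePair.ChildA.exists_cyclotomicFrame`, p728621)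
  obtain ⟨e, he, hcoh, heτ⟩ := exists_algHom_tower F.τ F.hτ
  -- Kato's witnesses at the pins (the typer's PLUG, binder for binder)
  obtain ⟨z, ℓ, L, f, u, r, hr0, hND, hBK, hVAL, hTRIV⟩ :=
    hK M g ι Ω ρ κ γ hg hΩ.isPlusPeriod hfrob hκ hγ I W n π.v π.hv (Θ π.v π.hv) (hΘ π.v π.hv) π.t₀ π.ht₀ π.nb π.bO π.bO' π.hbO
      π.ζ π.hζ π.ePk π.hμPk π.hadd₁Pk π.hadd₂Pk π.hgalPk π.hePk π.pair π.hpair F.Φ F.φ F.hΦφ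
      (fun k => IsCyclotomicExtension.zeta (2 ^ k) ℚ (CyclotomicField (2 ^ k) ℚ))
      (fun k => IsCyclotomicExtension.zeta_spec (2 ^ k) ℚ (CyclotomicField (2 ^ k) ℚ)) e F.τ hcoh heτ
  -- the POINTWISE port at the SAME `z` (slack modulus `μt := 1` explicit)
  obtain ⟨c', w, q, h⟩ := katoValuedClass_of_katoWitness W hcm hr hss ha hΔ M g ι Ω hM hg hcmg hg2 hΩ hcong κ γ hκ hγ hvar S₀ hS₀a hS₀b
    hS₀c Lp Lm d hPol hLm₁ hLm₂ n ρ Θ hfrob hΘ ϖ hϖ Sg hSg₁ hSg₂ hSg₃ hfin I hIC π F e he z ℓ L f u r hr0 hND hBK hVAL hTRIV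
  exact ⟨z, c', w, q, 1, h⟩

end Summit.BirchSwinnertonDyer.BirchSwinnertonDyer.Cruxes.ResidualThetaCountLowerPureAtTwo.SideaK3G29

end
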